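import Summits.QuantumFields.YangMills.Theorems.BalabanUVNodesN15VectorPieceUnitOwnForm

/-!
# Route «BalabanUVNodes», node N15 = NE2 — THE SITE DATUM `SiteRelDatum` INHABITED BY THE MASSIVE SITE FORM `c·1 + Q(G ⊗ 1)²Q*` OF THE PIECE
# (live η-defect letter), and `N15At` — all three conjuncts by name — HYPOTHESIS-FREE on a background-live family with NON-trivial `U ≡ 1` forms

Cell `pub-ymgap` (HUMAN RULING D-0062, Track A), seat `pub-ymgap-dag-n15-c` (generation g6; R134 (a) N15 NE2 s1).  Count-neutral; filed `--supports` the K3⁗ item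
(`--as helper`).  Imports BY NAME, nothing in the tree modified: g6 E2 `…N15VectorPieceUnitOwnForm` (`ownWeightBound`, `n15At_vectorPiece_vWordsExpC_of_siteRel`,
`hasMaj_mulOp_const`, `mulOp_const_comp_inv`), g5 R3s (`SiteRelDatum`), R1 (`hasMaj_idef_siteForm₀`), S1 (`siteInv`, `comp_siteInv`, `isUnit_stepE`, `hasMaj_siteInv`),
S2 (`siteForm₀`), g3 `uniform_layer_v1M`, g4 F4 `card_fibre_kingPrV_lift`.

THE POINT (third g6 file; companion of the erratum certificate E1 `…N15VectorPieceSiteVacuity` and of E2).  E1: the piece's own site form `Q(G ⊗ 1)²Q*` is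
singular — it cannot inhabit the site datum.  R4 (g5): identity forms inhabit `SiteRelDatum` (zero defect letter).  THIS FILE: the MASSIVE site form
`Kc := c·1 + Q(G ⊗ 1)²Q*` of the piece DOES inhabit `SiteRelDatum` for every mass `c ≥ c₀(β, δ, d)` — inverse by S1's Neumann device around `c⁻¹·1`
(`Q(G ⊗ 1)²Q* ≤ β²c_r·e^{−(δ−σ)d}` is small against `c`), decaying majorant `c⁻¹(1 − c⁻¹β²c_r³)⁻¹·e^{−ρd}`, and a LIVE η-defect letter: the masses cancel EXACTLY
in `𝔇(Kc′, Kc) = 𝔇(Q′(G′ ⊗ 1)²Q′*, Q(G ⊗ 1)²Q*)` (`idef_msiteForm`), which R1's Leibniz lemma bounds by `2βm₀c_r·θ_j·e^{−(δ−σ)d}` from g3's letters.  Hence, with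
E2's own unit forms: ★★★ `n15At_vectorPiece_vWordsExpC_massive` — `YMDAG.UVSplit.N15At` ALL THREE CONJUNCTS BY NAME with NO `U ≡ 1` datum displayed at all, on a
family whose site AND unit forms are non-trivial lattice operators of the model with NONZERO η-defect letters, every NE2⁰-type letter a theorem (windows:
`0 < |a| ≤ a₀`, `c ≥ c₀`).

* §1 (generic, namespace `…N15.SiteLayer`): `msiteForm c q G := c·1 + siteForm₀ q G`, `msiteInv`, `hasMaj_siteForm₀` (`QG²Q* ≤ β²c_r·e^{−ρd}`, `ρ + σ ≤ δ`),
  `idef_msiteForm` (masses cancel), ★ `msiteForm_comp_msiteInv`, ★ `hasMaj_msiteInv`.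
* §2 (namespace `…N15.VectorPiece`): `msiteInvV c j` ∕ `msiteInvV' c j`, ★★ **`siteRelDatum_massive`** (∃ c₀ > 0 ∀ c ≥ c₀ ∃ βS δS MS: `SiteRelDatum (msiteInvV c)
  (msiteInvV′ c) (massive forms) βS δS MS`), `massBound` (+`_pos`, `siteRelDatum_of_massBound_le`).
* §3 ★★★ **`n15At_vectorPiece_vWordsExpC_massive`**, closer `s_N15_of_vWordsExpCMassiveReading`.

HONEST FRAMING.  The mass `c` is NOT in Bałaban's site form (his `Q′G′²Q′*` is invertible because `G′` is the FULL positive propagator, [B6] p.235; Prop 2.3 gives the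
decay): `Kc` is a MODEL regularisation — an A2 certificate that the `_rel` site datum is inhabited by lattice operators with live letters, not an identification of the
printed object.  The honest `U ≡ 1` site form (full propagator) and its η-rate (NE2⁰-site, NOT PRINTED) remain the node's residue on this layer.  N15 NOT discharged (0∕1);
typed 28∕28 unmoved; one finite T⁴ programme at fixed ε — NOT ℝ⁴, NOT OS, NOT a mass gap, NOT Clay.  0 `sorry`, standard axioms.
-/

noncomputable section

open Finset

namespace Summit.QuantumFields.YangMills.BalabanUVNodes.N15.SiteLayer

open Literature.MathematicalPhysics.QuantumFieldTheory.Balaban1983to89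
open Literature.MathematicalPhysics.QuantumFieldTheory.Balaban1983to89.B11SectG (BlockNorm HasMaj RowSum hasMaj_comp_exp)
open Literature.MathematicalPhysics.QuantumFieldTheory.Balaban1983to89.T4EtaRateDefect (idef idef_add)
open Literature.MathematicalPhysics.QuantumFieldTheory.Balaban1983to89.T4EtaRateCoeffDefect (pull diagK fibre hasMaj_pull)
open Literature.MathematicalPhysics.QuantumFieldTheory.Balaban1983to89.B6RandomWalk (Triangle254)
open Literature.MathematicalPhysics.QuantumFieldTheory.Balaban1983to89.B6Prop26Gluing (mulOp mulOp_apply)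
open Summit.QuantumFields.YangMills.BalabanUVNodes.N15.BackgroundModel (kappa_ofBlocks)
open Summit.QuantumFields.YangMills.BalabanUVNodes.N15.BackgroundLayer (fibAvg hasMaj_fibAvg)

/-! ## §1 The massive site form `c·1 + QG²Q*` and its inverse for large mass (S1's Neumann device around `c⁻¹·1`) -/

section Massive

variable {X X' Y : Type} [Fintype X] [Fintype X'] [Fintype Y] [DecidableEq X] [DecidableEq X'] [DecidableEq Y] {g : B6.Geometry}

/-- THE MASSIVE SITE FORM `Kc = c·1 + Q∘G∘G∘Q*` (the `U ≡ 1` site form of S2 plus a site-diagonal mass — a MODEL regularisation). [cite: Balaban1985BackgroundPropagators, Thm 3.2 (3.48) p.398 (shape of the site form)] -/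
def msiteForm (c : ℝ) (q : X → Y) (G : (X → ℝ) →ₗ[ℝ] (X → ℝ)) : (Y → ℝ) →ₗ[ℝ] (Y → ℝ) :=
  mulOp (fun _ : Y => c) + siteForm₀ q G

/-- ITS INVERSE for large mass: S1's Neumann object `(1 − W(K₀ − Kc))⁻¹W` at `W = c⁻¹·1`, `K₀ = c·1`. [cite: Balaban1985BackgroundPropagators, (3.67) p.403 (Neumann mechanism)] -/
def msiteInv (c : ℝ) (q : X → Y) (G : (X → ℝ) →ₗ[ℝ] (X → ℝ)) : (Y → ℝ) →ₗ[ℝ] (Y → ℝ) :=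
  siteInv (mulOp fun _ : Y => c⁻¹) (mulOp fun _ : Y => c) (msiteForm c q G)

omit [Fintype Y] [DecidableEq X] [DecidableEq X'] in
/-- **THE MASSES CANCEL IN THE η-DEFECT**: `𝔇(Kc′, Kc) = 𝔇(Q′G′²Q′*, QG²Q*)` through the identity transports of the common site lattice. [folklore] -/
theorem idef_msiteForm (c : ℝ) (q : X → Y) (q' : X' → Y) (G : (X → ℝ) →ₗ[ℝ] (X → ℝ)) (G' : (X' → ℝ) →ₗ[ℝ] (X' → ℝ)) :
    idef LinearMap.id LinearMap.id (msiteForm c q' G') (msiteForm c q G) = idef LinearMap.id LinearMap.id (siteForm₀ q' G') (siteForm₀ q G) := by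
  rw [msiteForm, msiteForm, idef_add]
  have h0 : idef LinearMap.id LinearMap.id (mulOp fun _ : Y => c) (mulOp fun _ : Y => c) = 0 := by
    simp only [idef, LinearMap.comp_id, LinearMap.id_comp, sub_self]
  rw [h0, zero_add]

omit [DecidableEq X] in
/-- **`QG²Q* ≤ β²c_r·e^{−ρd}`** from `G ≤ β·e^{−δd}` (`ρ ≥ 0`, `ρ + σ ≤ δ`: one (2.61) row sum; `Q, Q* ≤ diagK 1`). [cite: Balaban1984PropagatorsII, (2.52)–(2.56) pp.232–233] -/
theorem hasMaj_siteForm₀ (htri : Triangle254 g) (hd : ∀ a b : g.Site, 0 ≤ g.dist a b) {σ cr : ℝ} (hrow : RowSum g σ cr) (hσ : 0 ≤ σ) (hcr : 0 ≤ cr)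
    (blk : X → g.Site) (blkY : Y → g.Site) (q : X → Y) (hq : ∀ x, blk x = blkY (q x)) {G : (X → ℝ) →ₗ[ℝ] (X → ℝ)} {β δ ρ : ℝ} (hβ : 0 ≤ β) (hρ : 0 ≤ ρ)
    (hρδ : ρ + σ ≤ δ)
    (hG : HasMaj (BlockNorm.ofBlocks g blk) (BlockNorm.ofBlocks g blk) G (fun y y' => β * Real.exp (-(δ * g.dist y y')))) :
    HasMaj (BlockNorm.ofBlocks g blkY) (BlockNorm.ofBlocks g blkY) (siteForm₀ q G) (fun y y' => β * β * cr * Real.exp (-(ρ * g.dist y y'))) := by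
  have hblk : blk = blkY ∘ q := funext hq
  subst hblk
  have hQ := hasMaj_fibAvg (g := g) (blkY ∘ q) blkY q fun _ => rfl
  have hQs : HasMaj (BlockNorm.ofBlocks g blkY) (BlockNorm.ofBlocks g (blkY ∘ q)) (pull q) (diagK fun _ => 1) := hasMaj_pull blkY q
  have hGG := hasMaj_comp_exp (b₁ := BlockNorm.ofBlocks g (blkY ∘ q)) (b₂ := BlockNorm.ofBlocks g (blkY ∘ q)) (b₃ := BlockNorm.ofBlocks g (blkY ∘ q))
    htri hd hrow hβ hβ hρ (by linarith) hρδ hG hG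
  rw [kappa_ofBlocks] at hGG
  have hc : 0 ≤ 1 * β * β * cr := by positivity
  have t1 := hasMaj_exp_comp_diagK (blkY ∘ q) hc hGG hQs
  have t2 := hasMaj_diagK_comp_exp (blkY ∘ q) zero_le_one hQ t1
  exact (t2.congr fun _ => rfl).mono fun y y' => le_of_eq (by ring)

variable (blkY : Y → g.Site) {σ cr : ℝ}

omit [Fintype X'] [DecidableEq X] [DecidableEq X'] in
/-- ★ **`Kc ∘ msiteInv = 1`** for `c > 0` with `c⁻¹·β²c_r·c_r² < 1` (`2σ ≤ δ`; S1 `comp_siteInv` + `isUnit_stepE`, the perturbation `Kc − c·1 = QG²Q*` at rate `δ − σ`).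
[cite: Balaban1985BackgroundPropagators, (3.67) p.403 (Neumann mechanism)] -/
theorem msiteForm_comp_msiteInv (blk : X → g.Site) (q : X → Y) (hq : ∀ x, blk x = blkY (q x)) (htri : Triangle254 g)
    (hd : ∀ a b : g.Site, 0 ≤ g.dist a b) (hd0 : ∀ y : g.Site, g.dist y y = 0) (hrow : RowSum g σ cr) (hσ : 0 ≤ σ) (hcr : 0 ≤ cr)
    {c : ℝ} (hc : 0 < c) {G : (X → ℝ) →ₗ[ℝ] (X → ℝ)} {β δ : ℝ} (hβ : 0 ≤ β) (hσδ : 2 * σ ≤ δ)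
    (hG : HasMaj (BlockNorm.ofBlocks g blk) (BlockNorm.ofBlocks g blk) G (fun y y' => β * Real.exp (-(δ * g.dist y y'))))
    (hsmall : |c⁻¹| * (β * β * cr) * cr * cr < 1) : msiteForm c q G ∘ₗ msiteInv c q G = LinearMap.id := by
  have hW := hasMaj_mulOp_const blkY hd0 c⁻¹ δ
  have hS := hasMaj_siteForm₀ htri hd hrow hσ hcr blk blkY q hq hβ (δ := δ) (ρ := δ - σ) (by linarith) (by linarith) hG
  have hC : HasMaj (BlockNorm.ofBlocks g blkY) (BlockNorm.ofBlocks g blkY) (mulOp (fun _ : Y => c) - msiteForm c q G)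
      (fun y y' => β * β * cr * Real.exp (-((δ - σ) * g.dist y y'))) :=
    hS.neg.congr fun μ => by rw [msiteForm]; abel_nf
  have hunit := isUnit_stepE blkY htri hd hrow hσ (abs_nonneg c⁻¹) (by positivity) hcr (ρ₁ := δ - σ) (by linarith) le_rfl (by linarith) hW hC hsmall
  exact comp_siteInv hunit (mulOp_const_comp_inv hc.ne')

omit [Fintype X'] [DecidableEq X] [DecidableEq X'] in
/-- ★ **THE MAJORANT OF THE MASSIVE INVERSE**: `msiteInv ≤ |c⁻¹|(1 − |c⁻¹|β²c_r³)⁻¹·e^{−ρd}` for `ρ ≥ 0`, `ρ + 3σ ≤ δ` (S1 `hasMaj_siteInv` at rate `δ − σ`).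
[cite: Balaban1985BackgroundPropagators, Thm 3.2 (3.48) p.398 (shape); Balaban1984PropagatorsII, (2.52)–(2.56) pp.232–233] -/
theorem hasMaj_msiteInv (blk : X → g.Site) (q : X → Y) (hq : ∀ x, blk x = blkY (q x)) (htri : Triangle254 g)
    (hd : ∀ a b : g.Site, 0 ≤ g.dist a b) (hd0 : ∀ y : g.Site, g.dist y y = 0) (hrow : RowSum g σ cr) (hσ : 0 ≤ σ) (hcr : 0 ≤ cr)
    (c : ℝ) {G : (X → ℝ) →ₗ[ℝ] (X → ℝ)} {β δ ρ : ℝ} (hβ : 0 ≤ β) (hρ : 0 ≤ ρ) (hρδ : ρ + 3 * σ ≤ δ)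
    (hG : HasMaj (BlockNorm.ofBlocks g blk) (BlockNorm.ofBlocks g blk) G (fun y y' => β * Real.exp (-(δ * g.dist y y'))))
    (hsmall : |c⁻¹| * (β * β * cr) * cr * cr < 1) :
    HasMaj (BlockNorm.ofBlocks g blkY) (BlockNorm.ofBlocks g blkY) (msiteInv c q G)
      (fun y y' => |c⁻¹| * (1 - |c⁻¹| * (β * β * cr) * cr * cr)⁻¹ * Real.exp (-(ρ * g.dist y y'))) := by
  have hW := hasMaj_mulOp_const blkY hd0 c⁻¹ (δ - σ)
  have hS := hasMaj_siteForm₀ htri hd hrow hσ hcr blk blkY q hq hβ (δ := δ) (ρ := δ - σ) (by linarith) (by linarith) hG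
  have hC : HasMaj (BlockNorm.ofBlocks g blkY) (BlockNorm.ofBlocks g blkY) (msiteForm c q G - mulOp (fun _ : Y => c))
      (fun y y' => β * β * cr * Real.exp (-((δ - σ) * g.dist y y'))) :=
    hS.congr fun μ => by rw [msiteForm]; abel_nf
  exact hasMaj_siteInv blkY htri hd hrow hσ hcr (abs_nonneg c⁻¹) (by positivity) hρ (by linarith) hW hC hsmall

end Massive

end Summit.QuantumFields.YangMills.BalabanUVNodes.N15.SiteLayer

namespace Summit.QuantumFields.YangMills.BalabanUVNodes.N15.VectorPiece

open Literature.MathematicalPhysics.QuantumFieldTheory.Balaban1983to89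
open Literature.MathematicalPhysics.QuantumFieldTheory.Balaban1983to89.B11SectG (BlockNorm HasMaj RowSum)
open Literature.MathematicalPhysics.QuantumFieldTheory.Balaban1983to89.T4Continuum
open Literature.MathematicalPhysics.QuantumFieldTheory.Balaban1983to89.T4EtaRateDefect (idef)
open Literature.MathematicalPhysics.QuantumFieldTheory.Balaban1983to89.B5Prop11Plancherel (Tor fine)
open Literature.MathematicalPhysics.QuantumFieldTheory.Balaban1983to89.B6UnitTorusCarrier (triangle254_unitTorusGeo rowSum_unitTorusGeo)
open Literature.MathematicalPhysics.QuantumFieldTheory.King1986.Torus (tdistT tdistT_nonneg tdistT_self)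
open Summit.QuantumFields.YangMills.BalabanUVNodes.N15.MatrixSpecies (liftMap liftBlk)
open Summit.QuantumFields.YangMills.BalabanUVNodes.N15.SiteLayer (unitForm₀ msiteForm msiteInv msiteForm_comp_msiteInv hasMaj_msiteInv idef_msiteForm
  hasMaj_idef_siteForm₀ hasMaj_exp_mono)
open YMDAG.UVSplit (N15At RateCarriers RateRecordPred S_N15 Datum)

variable {d : ℕ}

/-! ## §2 The massive site inverses of the vector piece ⊗ 1_𝔤; `SiteRelDatum` witnessed with a live defect letter -/

section Massive

variable (ι : Type) [Fintype ι] [DecidableEq ι] (L : ℕ) [NeZero L] (c : ℝ)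

/-- THE COARSE MASSIVE SITE INVERSE at a sized index: `(c·1 + Q(G ⊗ 1)²Q*)⁻¹` for the level-`L^k` piece. [bookkeeping] -/
def msiteInvV (j : VecIndexS d L) : ((Tor j.Mn × Fin (d + 1)) × ι → ℝ) →ₗ[ℝ] ((Tor j.Mn × Fin (d + 1)) × ι → ℝ) :=
  msiteInv c (liftMap (qbond L j.k j.Mn) ι) (tensorId ι (pieceG L j.Mn (L ^ j.k) j.k (rweight (d := d) L j.k)))

/-- THE FINE MASSIVE SITE INVERSE at a sized index (level `L^mL^k`, blocking through King's pairing). [bookkeeping] -/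
def msiteInvV' (j : VecIndexS d L) : ((Tor j.Mn × Fin (d + 1)) × ι → ℝ) →ₗ[ℝ] ((Tor j.Mn × Fin (d + 1)) × ι → ℝ) :=
  msiteInv c (liftMap (qbond L j.k j.Mn) ι ∘ liftMap (kingPrV L j.k j.m j.Mn) ι)
    (tensorId ι (pieceG L j.Mn (L ^ j.m * L ^ j.k) (j.k + j.m) (rweight (d := d) L j.k / ((L : ℝ) ^ j.m) ^ (d + 1))))

variable {ι L c}

/-- ★★ **`SiteRelDatum` WITNESSED BY THE MASSIVE SITE FORMS OF THE PIECE, WITH A LIVE DEFECT LETTER.**  For `d + 1 ≥ 2`, `L ≥ 1` there is `c₀ > 0` such that for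
every mass `c ≥ c₀`: `SiteRelDatum (msiteInvV c) (msiteInvV′ c) (c·1 + Q(G ⊗ 1)²Q*) (c·1 + Q′(G′ ⊗ 1)²Q′*) βS δS MS` for some `βS ≥ 0`, `δS > 0`, `MS ≥ 0` uniform in the
sized index — inverse (S1 Neumann), inverse identity, decaying majorant, and the η-defect letter `𝔇(Kc′, Kc) = 𝔇(Q′G′²Q′*, QG²Q*) ≤ MS·θ_j·e^{−δS d}` (masses cancel; R1's
Leibniz on g3's `𝔇(G′ ⊗ 1, G ⊗ 1)`), ALL PROVED. [cite: Balaban1985BackgroundPropagators, Thm 3.2 (3.48) p.398 (shape); Balaban1984PropagatorsII, (2.52)–(2.56) pp.232–233] -/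
theorem siteRelDatum_massive (hd : 1 ≤ d) (hL : 1 ≤ L) : ∃ c₀ : ℝ, 0 < c₀ ∧ ∀ c : ℝ, c₀ ≤ c → ∃ βS δS MS : ℝ,
    SiteRelDatum (d := d) (ι := ι) (L := L) (msiteInvV ι L c) (msiteInvV' ι L c)
      (fun j => msiteForm c (liftMap (qbond L j.k j.Mn) ι) (tensorId ι (pieceG L j.Mn (L ^ j.k) j.k (rweight (d := d) L j.k))))
      (fun j => msiteForm c (liftMap (qbond L j.k j.Mn) ι ∘ liftMap (kingPrV L j.k j.m j.Mn) ι)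
        (tensorId ι (pieceG L j.Mn (L ^ j.m * L ^ j.k) (j.k + j.m) (rweight (d := d) L j.k / ((L : ℝ) ^ j.m) ^ (d + 1))))) βS δS MS := by
  obtain ⟨β, δ, m₀, hβ, hδ, hm₀, H⟩ := uniform_layer_v1M (d := d) (ι := ι) (L := L) hd hL
  set σ : ℝ := δ / 6 with hσdef
  have hσ : 0 < σ := by positivity
  set cr : ℝ := B4Sect5Proof.latticeConst (d + 1) σ with hcrdef
  have hcr : 0 ≤ cr := B4Sect5Proof.latticeConst_nonneg (d + 1) hσ.le
  set R : ℝ := β * β * cr * cr * cr with hRdef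
  have hR : 0 ≤ R := by positivity
  refine ⟨2 * (R + 1), by positivity, fun c hcc => ?_⟩
  have hc : 0 < c := lt_of_lt_of_le (by positivity) hcc
  have hcinv : |c⁻¹| = c⁻¹ := abs_of_pos (inv_pos.mpr hc)
  have hsmall : |c⁻¹| * (β * β * cr) * cr * cr < 1 := by
    rw [hcinv]
    have h1 : c⁻¹ * (β * β * cr) * cr * cr = R / c := by rw [hRdef]; ring
    rw [h1, div_lt_one hc]
    linarith
  have hq1 : 0 < 1 - |c⁻¹| * (β * β * cr) * cr * cr := by linarith
  set βS : ℝ := |c⁻¹| * (1 - |c⁻¹| * (β * β * cr) * cr * cr)⁻¹ with hβSdef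
  have hβS : 0 ≤ βS := mul_nonneg (abs_nonneg _) (inv_nonneg.mpr hq1.le)
  have hδ2 : 0 < δ / 2 := by positivity
  have hMS : 0 ≤ 2 * β * m₀ * cr := by positivity
  have hdist : ∀ (j : VecIndexS d L) (y y' : (unitTorusGeoS L j.k j.Mn j.Msz).Site), 0 ≤ (unitTorusGeoS L j.k j.Mn j.Msz).dist y y' :=
    fun j y y' => tdistT_nonneg _ _ _
  have hd0 : ∀ (j : VecIndexS d L) (y : (unitTorusGeoS L j.k j.Mn j.Msz).Site), (unitTorusGeoS L j.k j.Mn j.Msz).dist y y = 0 := fun j y => tdistT_self _ _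
  -- coarse: identity and majorant
  have hKW : ∀ j : VecIndexS d L, msiteForm c (liftMap (qbond L j.k j.Mn) ι) (tensorId ι (pieceG L j.Mn (L ^ j.k) j.k (rweight (d := d) L j.k))) ∘ₗ
      msiteInvV ι L c j = LinearMap.id := fun j =>
    msiteForm_comp_msiteInv (g := unitTorusGeoS L j.k j.Mn j.Msz) (liftBlk (fun b : Tor j.Mn × Fin (d + 1) => b.1) ι) (liftBlk (blkFine L j.k j.Mn) ι)
      (liftMap (qbond L j.k j.Mn) ι) (fun _ => rfl) (triangle254_unitTorusGeo L j.k j.Mn) (hdist j) (hd0 j) (rowSum_unitTorusGeo L j.k j.Mn hσ) hσ.le hcr hc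
      hβ.le (by linarith) (H j).1 hsmall
  have hWs : ∀ j : VecIndexS d L, HasMaj (BlockNorm.ofBlocks (unitTorusGeoS L j.k j.Mn j.Msz) (liftBlk (fun b : Tor j.Mn × Fin (d + 1) => b.1) ι))
      (BlockNorm.ofBlocks (unitTorusGeoS L j.k j.Mn j.Msz) (liftBlk (fun b : Tor j.Mn × Fin (d + 1) => b.1) ι)) (msiteInvV ι L c j)
      (fun y y' => βS * Real.exp (-(δ / 2 * (unitTorusGeoS L j.k j.Mn j.Msz).dist y y'))) := fun j =>
    hasMaj_msiteInv (g := unitTorusGeoS L j.k j.Mn j.Msz) (liftBlk (fun b : Tor j.Mn × Fin (d + 1) => b.1) ι) (liftBlk (blkFine L j.k j.Mn) ι)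
      (liftMap (qbond L j.k j.Mn) ι) (fun _ => rfl) (triangle254_unitTorusGeo L j.k j.Mn) (hdist j) (hd0 j) (rowSum_unitTorusGeo L j.k j.Mn hσ) hσ.le hcr c
      hβ.le hδ2.le (by linarith) (H j).1 hsmall
  -- fine: identity and majorant
  have hKW' : ∀ j : VecIndexS d L, msiteForm c (liftMap (qbond L j.k j.Mn) ι ∘ liftMap (kingPrV L j.k j.m j.Mn) ι)
      (tensorId ι (pieceG L j.Mn (L ^ j.m * L ^ j.k) (j.k + j.m) (rweight (d := d) L j.k / ((L : ℝ) ^ j.m) ^ (d + 1)))) ∘ₗ msiteInvV' ι L c j =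
      LinearMap.id := fun j =>
    msiteForm_comp_msiteInv (g := unitTorusGeoS L j.k j.Mn j.Msz) (liftBlk (fun b : Tor j.Mn × Fin (d + 1) => b.1) ι)
      (liftBlk (blkFine L j.k j.Mn ∘ kingPrV L j.k j.m j.Mn) ι) (liftMap (qbond L j.k j.Mn) ι ∘ liftMap (kingPrV L j.k j.m j.Mn) ι) (fun _ => rfl)
      (triangle254_unitTorusGeo L j.k j.Mn) (hdist j) (hd0 j) (rowSum_unitTorusGeo L j.k j.Mn hσ) hσ.le hcr hc hβ.le (by linarith) (H j).2.2.1 hsmall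
  have hWs' : ∀ j : VecIndexS d L, HasMaj (BlockNorm.ofBlocks (unitTorusGeoS L j.k j.Mn j.Msz) (liftBlk (fun b : Tor j.Mn × Fin (d + 1) => b.1) ι))
      (BlockNorm.ofBlocks (unitTorusGeoS L j.k j.Mn j.Msz) (liftBlk (fun b : Tor j.Mn × Fin (d + 1) => b.1) ι)) (msiteInvV' ι L c j)
      (fun y y' => βS * Real.exp (-(δ / 2 * (unitTorusGeoS L j.k j.Mn j.Msz).dist y y'))) := fun j =>
    hasMaj_msiteInv (g := unitTorusGeoS L j.k j.Mn j.Msz) (liftBlk (fun b : Tor j.Mn × Fin (d + 1) => b.1) ι)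
      (liftBlk (blkFine L j.k j.Mn ∘ kingPrV L j.k j.m j.Mn) ι) (liftMap (qbond L j.k j.Mn) ι ∘ liftMap (kingPrV L j.k j.m j.Mn) ι) (fun _ => rfl)
      (triangle254_unitTorusGeo L j.k j.Mn) (hdist j) (hd0 j) (rowSum_unitTorusGeo L j.k j.Mn hσ) hσ.le hcr c hβ.le hδ2.le (by linarith) (H j).2.2.1 hsmall
  -- the η-defect of the massive forms: masses cancel, then R1's Leibniz at rate δ/2
  have hDK : ∀ j : VecIndexS d L, HasMaj (BlockNorm.ofBlocks (unitTorusGeoS L j.k j.Mn j.Msz) (liftBlk (fun b : Tor j.Mn × Fin (d + 1) => b.1) ι))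
      (BlockNorm.ofBlocks (unitTorusGeoS L j.k j.Mn j.Msz) (liftBlk (fun b : Tor j.Mn × Fin (d + 1) => b.1) ι))
      (idef LinearMap.id LinearMap.id
        (msiteForm c (liftMap (qbond L j.k j.Mn) ι ∘ liftMap (kingPrV L j.k j.m j.Mn) ι)
          (tensorId ι (pieceG L j.Mn (L ^ j.m * L ^ j.k) (j.k + j.m) (rweight (d := d) L j.k / ((L : ℝ) ^ j.m) ^ (d + 1)))))
        (msiteForm c (liftMap (qbond L j.k j.Mn) ι) (tensorId ι (pieceG L j.Mn (L ^ j.k) j.k (rweight (d := d) L j.k)))))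
      (fun y y' => 2 * β * m₀ * cr * thetaV L j * Real.exp (-(δ / 2 * (unitTorusGeoS L j.k j.Mn j.Msz).dist y y'))) := fun j => by
    have hθ : 0 ≤ thetaV L j := by unfold thetaV; positivity
    rw [idef_msiteForm]
    have key := hasMaj_idef_siteForm₀ (g := unitTorusGeoS L j.k j.Mn j.Msz) (triangle254_unitTorusGeo L j.k j.Mn) (hdist j) (rowSum_unitTorusGeo L j.k j.Mn hσ)
      (liftBlk (blkFine L j.k j.Mn) ι) (liftBlk (fun b : Tor j.Mn × Fin (d + 1) => b.1) ι) (liftMap (qbond L j.k j.Mn) ι) (liftMap (kingPrV L j.k j.m j.Mn) ι)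
      (fun _ => rfl) (pow_ne_zero _ (pow_ne_zero _ (NeZero.ne L))) (card_fibre_kingPrV_lift L j.k j.m j.Mn ι) hβ.le (mul_nonneg hm₀.le hθ) hδ2.le
      (show δ / 2 + σ ≤ δ by linarith) hσ.le (H j).1 (H j).2.2.1 (H j).2.2.2.2.2.2.2.1
    exact key.mono fun y y' => le_of_eq (by ring)
  exact ⟨βS, δ / 2, 2 * β * m₀ * cr, hβS, hδ2, hMS, hWs, hWs', hKW, hKW', hDK⟩

variable (ι L)

/-- THE CERTIFIED MASS WINDOW `c₀ > 0` of `siteRelDatum_massive` (a choice; depends on the piece's uniform `U ≡ 1` letters only). [bookkeeping] -/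
def massBound (hd : 1 ≤ d) (hL : 1 ≤ L) : ℝ := Classical.choose (siteRelDatum_massive (d := d) (ι := ι) (L := L) hd hL)

/-- `c₀ > 0`. [bookkeeping] -/
theorem massBound_pos (hd : 1 ≤ d) (hL : 1 ≤ L) : 0 < massBound (d := d) ι L hd hL :=
  (Classical.choose_spec (siteRelDatum_massive (d := d) (ι := ι) (L := L) hd hL)).1

/-- In the window `c ≥ c₀` the site datum is witnessed by the massive forms. [bookkeeping] -/
theorem siteRelDatum_of_massBound_le (hd : 1 ≤ d) (hL : 1 ≤ L) {c : ℝ} (hcc : massBound (d := d) ι L hd hL ≤ c) :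
    ∃ βS δS MS : ℝ,
      SiteRelDatum (d := d) (ι := ι) (L := L) (msiteInvV ι L c) (msiteInvV' ι L c)
        (fun j => msiteForm c (liftMap (qbond L j.k j.Mn) ι) (tensorId ι (pieceG L j.Mn (L ^ j.k) j.k (rweight (d := d) L j.k))))
        (fun j => msiteForm c (liftMap (qbond L j.k j.Mn) ι ∘ liftMap (kingPrV L j.k j.m j.Mn) ι)
          (tensorId ι (pieceG L j.Mn (L ^ j.m * L ^ j.k) (j.k + j.m) (rweight (d := d) L j.k / ((L : ℝ) ^ j.m) ^ (d + 1))))) βS δS MS :=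
  (Classical.choose_spec (siteRelDatum_massive (d := d) (ι := ι) (L := L) hd hL)).2 c hcc

end Massive

/-! ## §3 `N15At` — all three conjuncts by name — with NO `U ≡ 1` datum displayed (massive site forms, own unit forms) -/

section Faces

variable (𝔄 : Type) [NormedRing 𝔄] [NormedAlgebra ℝ 𝔄] [CompleteSpace 𝔄] (ι : Type) [Fintype ι] [DecidableEq ι] (e : 𝔄 ≃L[ℝ] (ι → ℝ)) (L : ℕ) [NeZero L]

/-- ★★★ **`N15At` HYPOTHESIS-FREE ON A BACKGROUND-LIVE FAMILY WITH NON-TRIVIAL `U ≡ 1` FORMS** (parallel-transport species; `d + 1 ≥ 2`, `L ≥ 2`, `c₃₅ > 0`, any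
`p`; weight `0 < |a| ≤ a₀`, mass `c ≥ c₀`): E2's `n15At_vectorPiece_vWordsExpC_of_siteRel` with its site datum DISCHARGED by `siteRelDatum_massive` — operator = g4 F16,
site = g5 R3s at the MASSIVE site forms `c·1 + Q(G ⊗ 1)²Q*` (live defect letter), unit = g5 R3u at the piece's own unit forms; every NE2⁰-type letter a theorem.
NOT Bałaban's site form (no mass there): a model-level certificate. [bookkeeping] -/
theorem n15At_vectorPiece_vWordsExpC_massive (hd : 1 ≤ d) (hL : 1 ≤ L) (hL2 : 2 ≤ L) {c35 : ℝ} (hc35 : 0 < c35) (p : ℝ) {a : ℝ} (ha : a ≠ 0)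
    (haa : |a| ≤ ownWeightBound (d := d) ι L hd hL) {c : ℝ} (hcc : massBound (d := d) ι L hd hL ≤ c) :
    N15At { I := VecIndexS d L, c35 := c35, p := p, pi := v1GVecInstance (d := d) 𝔄 ι L hL,
            Kop := vWGCVecFamily4 (d := d) 𝔄 ι e L a hL (expFc ι e L) (expFsc ι e L) (expFf ι e L) (expFsf ι e L),
            Ksite := vWGCVecSiteRelKernel (d := d) 𝔄 ι e L a hL (expFc ι e L) (expFsc ι e L) (expFf ι e L) (expFsf ι e L) (msiteInvV ι L c) (msiteInvV' ι L c)
              (fun j => msiteForm c (liftMap (qbond L j.k j.Mn) ι) (tensorId ι (pieceG L j.Mn (L ^ j.k) j.k (rweight (d := d) L j.k))))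
              (fun j => msiteForm c (liftMap (qbond L j.k j.Mn) ι ∘ liftMap (kingPrV L j.k j.m j.Mn) ι)
                (tensorId ι (pieceG L j.Mn (L ^ j.m * L ^ j.k) (j.k + j.m) (rweight (d := d) L j.k / ((L : ℝ) ^ j.m) ^ (d + 1))))),
            Kunit := vWGCVecUnitRelKernel (d := d) 𝔄 ι e L a hL (expFc ι e L) (expFsc ι e L) (expFf ι e L) (expFsf ι e L)
              (ownUnitInvV ι L a) (ownUnitInvV' ι L a)
              (fun j => unitForm₀ a (liftMap (qbond L j.k j.Mn) ι) (tensorId ι (pieceG L j.Mn (L ^ j.k) j.k (rweight (d := d) L j.k))))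
              (fun j => unitForm₀ a (liftMap (qbond L j.k j.Mn) ι ∘ liftMap (kingPrV L j.k j.m j.Mn) ι)
                (tensorId ι (pieceG L j.Mn (L ^ j.m * L ^ j.k) (j.k + j.m) (rweight (d := d) L j.k / ((L : ℝ) ^ j.m) ^ (d + 1))))),
            inΛ := fun _ _ => True, unitDist := fun j => (unitTorusGeoS L j.k j.Mn j.Msz).dist } := by
  obtain ⟨βS, δS, MS, hS⟩ := siteRelDatum_of_massBound_le (d := d) ι L hd hL hcc
  exact n15At_vectorPiece_vWordsExpC_of_siteRel 𝔄 ι e L hd hL hL2 hc35 p ha haa hS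

variable {N : ℕ} [NeZero N] in
/-- **`S_N15` FOR EVERY PARALLEL-TRANSPORT-SPECIES READING IN THE TWO CERTIFIED WINDOWS** — the K4 stub closed over every rate-carrier predicate whose NE2 component
is the record above: NO layer and NO `U ≡ 1` datum is a hypothesis (model-level). [bookkeeping] -/
theorem s_N15_of_vWordsExpCMassiveReading (hd : 1 ≤ d) (hL : 1 ≤ L) (hL2 : 2 ≤ L) (RRec : RateRecordPred N)
    (hread : ∀ (F : T4Family) (D : Datum F N) (g₀ : ℕ → ℝ) (os : List (ULoop F)) (R : RateCarriers N), RRec F D g₀ os R →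
      ∃ (a c c35 p : ℝ), a ≠ 0 ∧ |a| ≤ ownWeightBound (d := d) ι L hd hL ∧ massBound (d := d) ι L hd hL ≤ c ∧ 0 < c35 ∧
        R.ne2 = { I := VecIndexS d L, c35 := c35, p := p, pi := v1GVecInstance (d := d) 𝔄 ι L hL,
                  Kop := vWGCVecFamily4 (d := d) 𝔄 ι e L a hL (expFc ι e L) (expFsc ι e L) (expFf ι e L) (expFsf ι e L),
                  Ksite := vWGCVecSiteRelKernel (d := d) 𝔄 ι e L a hL (expFc ι e L) (expFsc ι e L) (expFf ι e L) (expFsf ι e L) (msiteInvV ι L c)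
                    (msiteInvV' ι L c)
                    (fun j => msiteForm c (liftMap (qbond L j.k j.Mn) ι) (tensorId ι (pieceG L j.Mn (L ^ j.k) j.k (rweight (d := d) L j.k))))
                    (fun j => msiteForm c (liftMap (qbond L j.k j.Mn) ι ∘ liftMap (kingPrV L j.k j.m j.Mn) ι)
                      (tensorId ι (pieceG L j.Mn (L ^ j.m * L ^ j.k) (j.k + j.m) (rweight (d := d) L j.k / ((L : ℝ) ^ j.m) ^ (d + 1))))),
                  Kunit := vWGCVecUnitRelKernel (d := d) 𝔄 ι e L a hL (expFc ι e L) (expFsc ι e L) (expFf ι e L) (expFsf ι e L)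
                    (ownUnitInvV ι L a) (ownUnitInvV' ι L a)
                    (fun j => unitForm₀ a (liftMap (qbond L j.k j.Mn) ι) (tensorId ι (pieceG L j.Mn (L ^ j.k) j.k (rweight (d := d) L j.k))))
                    (fun j => unitForm₀ a (liftMap (qbond L j.k j.Mn) ι ∘ liftMap (kingPrV L j.k j.m j.Mn) ι)
                      (tensorId ι (pieceG L j.Mn (L ^ j.m * L ^ j.k) (j.k + j.m) (rweight (d := d) L j.k / ((L : ℝ) ^ j.m) ^ (d + 1))))),
                  inΛ := fun _ _ => True, unitDist := fun j => (unitTorusGeoS L j.k j.Mn j.Msz).dist }) :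
    S_N15 RRec := by
  intro F D g₀ os R hR
  obtain ⟨a, c, c35, p, ha, haa, hcc, hc35, hne2⟩ := hread F D g₀ os R hR
  rw [hne2]
  exact n15At_vectorPiece_vWordsExpC_massive 𝔄 ι e L hd hL hL2 hc35 p ha haa hcc

end Faces

end Summit.QuantumFields.YangMills.BalabanUVNodes.N15.VectorPiece

end
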